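import Literature.NumberTheory.Transcendental.NesterenkoMultiplicity
import Literature.Barriers.Schanuel.NesterenkoModularScopeMultiplicityProofs
import Literature.Barriers.Schanuel.NesterenkoModularScopeAnalytic
import Literature.Barriers.Schanuel.NesterenkoModularScopeMeasureInduction
import HarnessLib

/-!
# Barrier (Schanuel) `NesterenkoModularScope`: Ch. 10 Theorem 1.1 for the Ramanujan system from the general Theorem 1.1 — proofs only

`Literature/Barriers/Schanuel/NesterenkoModularScopeMultiplicityGeneralProofs.lean` — proofs only
(no new definitions). The tree holds Nesterenko's multiplicity estimate (LNM 1752 Ch. 10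
Theorem 1.1) twice as a named fact: in general form,
`Literature.NumberTheory.Transcendental.NesterenkoMultiplicity.NesterenkoPhilippon2001_ch10_thm_1_1`
(`NesterenkoMultiplicity.lean`), and specialised to `m = 3` and the system (45),
`NesterenkoPhilippon2001_ch10_thm_1_1_ramanujan` (`NesterenkoModularScopeMultiplicity.lean`), from
which `ch3_thm_2_3_of_thm_1_1_of_prop_5_1` derives Ch. 3 Theorem 2.3. This file proves the
specialisation from the general fact — `ch10_thm_1_1_ramanujan_of_general` — by supplying the
printed data of Example 3 (p. 151): (45) is (39) with `A₀ = 12z`, `A₁ = x₁² − x₂`,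
`A₂ = 4(x₁x₂ − x₃)`, `A₃ = 6(x₁x₃ − x₂²)` (no non-constant common divisor: a common divisor
divides `12z` and `z ∤ x₁² − x₂`), `f̄ = (P, Q, R)` analytic at `0` (coefficients `O((n+1)⁶)`,
`NesterenkoModularScopeAnalytic.lean`), solving (45) (`ramanujan_system_complex`), the operator (40)
being `12D` (so `D`-stability in either sense agrees) and `deg_x̲` the weighted degree for
`(0, 1, 1, 1)`. Hence the specialised fact is no longer an independent trust assumption:

* `ch3_thm_2_3_of_general_ch10` — Ch. 3 Theorem 2.3 from the general Theorem 1.1 and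
  Proposition 5.1;
* `nesterenkoModularScope_of_toolkit_of_general_ch10`, `nesterenkoModularScope_of_mainCriterion_of_general_ch10`
  — the barrier declaration on the trust bases {§4 facts of Ch. 3, Ch. 10 Thm 1.1, Prop 5.1} and
  {Philippon 1986 Thm 2.11, Ch. 10 Thm 1.1, Prop 5.1}.

## References

* [NesterenkoPhilippon2001] LNM 1752 (2001), Ch. 10 §1 (39), (40), Example 3 (45), Theorem 1.1,
  Theorem 1.3 (pp. 149–151).
-/

noncomputable section

open MvPolynomial
open Literature.NumberTheory.Transcendental Literature.NumberTheory.Transcendental.NesterenkoMultiplicity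

namespace Literature.Barriers.Schanuel

/-- `deg_x̲` of `NesterenkoMultiplicity` (sum of the exponents of `x₁, x₂, x₃`) is the weighted total
degree for the weight `(0, 1, 1, 1)` of `NesterenkoModularScopeMultiplicity`. [folklore] -/
theorem xDegree_eq_weightedTotalDegree (E : Rzx 3) :
    xDegree E = E.weightedTotalDegree xWeight := by
  unfold xDegree weightedTotalDegree
  refine Finset.sup_congr rfl fun e _ => ?_
  rw [weight_xWeight, Fin.sum_univ_three]
  rfl

/-- The operator (40) of the system (45) in the form (39) is `12D`: for
`A = (12z, x₁² − x₂, 4(x₁x₂ − x₃), 6(x₁x₃ − x₂²))`, `dOp A E = 12 · D E`.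
[cite: NesterenkoPhilippon2001, Ch. 10 §1 (40), (45) and §5 (p. 162)] -/
theorem dOp_ramanujan_eq (E : Rzx 3) :
    dOp (![12 * X 0, X 1 ^ 2 - X 2, 4 * (X 1 * X 2 - X 3), 6 * (X 1 * X 3 - X 2 ^ 2)] :
      Fin 4 → Rzx 3) E = 12 * ramanujanD E := by
  set A : Fin 4 → Rzx 3 :=
    ![12 * X 0, X 1 ^ 2 - X 2, 4 * (X 1 * X 2 - X 3), 6 * (X 1 * X 3 - X 2 ^ 2)] with hA
  have hC12 : (12 : Rzx 3) = C 12 := (map_ofNat C 12).symm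
  have hvar : ∀ i : Fin 4, A i = 12 * ramanujanDValues i := by
    intro i
    fin_cases i
    · simp [hA, ramanujanDValues]
    · simp only [hA, ramanujanDValues, Fin.mk_one, Matrix.cons_val_one, Matrix.cons_val_zero]
      rw [hC12, ← mul_assoc, ← C_mul]; norm_num
    · simp only [hA, ramanujanDValues, Fin.reduceFinMk, Matrix.cons_val]
      rw [hC12, ← mul_assoc, ← C_mul, show (4 : Rzx 3) = C 4 from (map_ofNat C 4).symm]
      norm_num
    · simp only [hA, ramanujanDValues, Fin.reduceFinMk, Matrix.cons_val]
      rw [hC12, ← mul_assoc, ← C_mul, show (6 : Rzx 3) = C 6 from (map_ofNat C 6).symm]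
      norm_num
  induction E using MvPolynomial.induction_on with
  | C a =>
    have h1 : ∀ i : Fin 4, pderiv i (C a : Rzx 3) = 0 := fun i => pderiv_C
    have h2 : ramanujanD (C a : Rzx 3) = 0 := ramanujanD.map_algebraMap a
    simp [dOp, h1, h2]
  | add p q hp hq => rw [dOp_add, map_add, mul_add, hp, hq]
  | mul_X p i hp =>
    rw [dOp_mul, hp, dOp_X, hvar, Derivation.leibniz, smul_eq_mul, smul_eq_mul, ramanujanD_X]
    ring

/-- **Ch. 10 Theorem 1.1 for `m = 3` and the system (45) from the general Theorem 1.1**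
(Example 3, p. 151: `P, Q, R` "form a solution of the system of differential equations (45)" and
are analytic at `0`). [cite: NesterenkoPhilippon2001, Ch. 10 §1 Example 3, Theorem 1.3 (p. 151)] -/
theorem ch10_thm_1_1_ramanujan_of_general (h : NesterenkoMultiplicity.NesterenkoPhilippon2001_ch10_thm_1_1) :
    NesterenkoPhilippon2001_ch10_thm_1_1_ramanujan := by
  intro _ hD
  obtain ⟨c, hc⟩ := hD
  set A : Fin 4 → Rzx 3 :=
    ![12 * X 0, X 1 ^ 2 - X 2, 4 * (X 1 * X 2 - X 3), 6 * (X 1 * X 3 - X 2 ^ 2)] with hA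
  set f : Fin 3 → PowerSeries ℂ :=
    ![ramanujanPSeries.map (Int.castRingHom ℂ), ramanujanQSeries.map (Int.castRingHom ℂ), ramanujanRSeries.map (Int.castRingHom ℂ)] with hf
  -- the substitution `(z, x̄) ↦ (z, P, Q, R)` is the formal composite of Ch. 3
  have hgen : (Fin.cons PowerSeries.X f : Fin 4 → PowerSeries ℂ) =
      ![PowerSeries.X, ramanujanPSeries.map (Int.castRingHom ℂ), ramanujanQSeries.map (Int.castRingHom ℂ), ramanujanRSeries.map (Int.castRingHom ℂ)] := by
    funext i
    fin_cases i <;> rfl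
  have hsubst : ∀ E : Rzx 3, substSeries f E = ramanujanComposite E := fun E => by
    unfold substSeries ramanujanComposite
    rw [hgen]
  -- (39): no non-constant common divisor
  have hC12 : (12 : Rzx 3) = C 12 := (map_ofNat C 12).symm
  have hND : NoCommonDivisor A := by
    intro G hG
    have h0 : G ∣ 12 * X 0 := by simpa [hA] using hG 0
    have h1 : G ∣ X 1 ^ 2 - X 2 := by simpa [hA] using hG 1
    obtain ⟨K, hK⟩ := h0
    have h12 : (12 * X 0 : Rzx 3) ≠ 0 := by
      rw [hC12]
      exact mul_ne_zero (by rw [Ne, C_eq_zero]; norm_num) (X_ne_zero 0)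
    have hG0 : G ≠ 0 := by
      rintro rfl; rw [zero_mul] at hK; exact h12 hK
    have hK0 : K ≠ 0 := by
      rintro rfl; rw [mul_zero] at hK; exact h12 hK
    have hdeg : G.totalDegree + K.totalDegree = 1 := by
      rw [← totalDegree_mul_of_isDomain hG0 hK0, ← hK, hC12,
        totalDegree_mul_of_isDomain (by rw [Ne, C_eq_zero]; norm_num) (X_ne_zero 0), totalDegree_C,
        totalDegree_X]
    by_contra hne
    have hKd : K.totalDegree = 0 := by omega
    obtain ⟨k, hk⟩ : ∃ k : ℂ, K = C k := ⟨_, totalDegree_eq_zero_iff_eq_C.mp hKd⟩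
    have hk0 : k ≠ 0 := fun h => hK0 (by rw [hk, h, C_0])
    have hGeq : G = X 0 * (12 * C k⁻¹) := by
      have : G = G * K * C k⁻¹ := by
        rw [hk, mul_assoc, ← C_mul, mul_inv_cancel₀ hk0, C_1, mul_one]
      rw [this, ← hK]
      ring
    have hX : (X 0 : Rzx 3) ∣ X 1 ^ 2 - X 2 := (Dvd.intro _ hGeq.symm).trans h1
    obtain ⟨H, hH⟩ := hX
    have := congrArg (MvPolynomial.eval (fun i : Fin 4 => if i = 1 then (1 : ℂ) else 0)) hH
    simp at this
  -- analyticity at `0`: coefficients `O((n+1)⁶)`, convergence at `|z| = 1/2`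
  have hrad : ∀ j : Fin 3, HasPosRadius (f j) := by
    intro j
    refine ⟨1 / 2, by norm_num, ?_⟩
    have h := summable_norm_mul_pow_of_le (norm_coeff_generator_le j.succ)
      (z := (1 / 2 : ℂ)) (by norm_num)
    have e : f j = (![PowerSeries.X, ramanujanPSeries.map (Int.castRingHom ℂ), ramanujanQSeries.map (Int.castRingHom ℂ),
        ramanujanRSeries.map (Int.castRingHom ℂ)] : Fin 4 → PowerSeries ℂ) j.succ := by
      fin_cases j <;> rfl
    rw [e]
    refine h.congr fun n => ?_
    rw [norm_mul, norm_pow]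
    norm_num
  -- (45): `12z · f_j' = A_j(z, f̄)`
  have hsol : IsSolution A f := by
    obtain ⟨h1, h2, h3⟩ := ramanujan_system_complex
    simp only [ramanujanTheta_eq_X_mul_derivative] at h1 h2 h3
    have hA0 : substSeries f (A 0) = 12 * PowerSeries.X := by
      rw [hsubst]; simp [hA, ramanujanComposite, map_ofNat]
    have E0 : substSeries f (A 1) = (ramanujanPSeries.map (Int.castRingHom ℂ)) ^ 2 - ramanujanQSeries.map (Int.castRingHom ℂ) := by
      rw [hsubst]; simp [hA, ramanujanComposite]
    have E1 : substSeries f (A 2) =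
        4 * (ramanujanPSeries.map (Int.castRingHom ℂ) * ramanujanQSeries.map (Int.castRingHom ℂ) - ramanujanRSeries.map (Int.castRingHom ℂ)) := by
      rw [hsubst]; simp [hA, ramanujanComposite, map_ofNat]
    have E2 : substSeries f (A 3) =
        6 * (ramanujanPSeries.map (Int.castRingHom ℂ) * ramanujanRSeries.map (Int.castRingHom ℂ) - (ramanujanQSeries.map (Int.castRingHom ℂ)) ^ 2) := by
      rw [hsubst]; simp [hA, ramanujanComposite, map_ofNat]
    have c12 : (12 : PowerSeries ℂ) * PowerSeries.C (1 / 12 : ℂ) = 1 := by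
      rw [← map_ofNat (PowerSeries.C (R := ℂ)) 12, ← map_mul, ← map_one (PowerSeries.C (R := ℂ))]
      norm_num
    have c3 : (12 : PowerSeries ℂ) * PowerSeries.C (1 / 3 : ℂ) = 4 := by
      rw [← map_ofNat (PowerSeries.C (R := ℂ)) 12, ← map_mul, ← map_ofNat (PowerSeries.C (R := ℂ)) 4]
      norm_num
    have c2 : (12 : PowerSeries ℂ) * PowerSeries.C (1 / 2 : ℂ) = 6 := by
      rw [← map_ofNat (PowerSeries.C (R := ℂ)) 12, ← map_mul, ← map_ofNat (PowerSeries.C (R := ℂ)) 6]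
      norm_num
    refine ⟨?_, fun j => ?_⟩
    · rw [hA0]
      intro h0
      have := congrArg (PowerSeries.coeff 1) h0
      simp at this
      rw [map_ofNat] at this
      norm_num at this
    · rw [hA0]
      fin_cases j
      · show 12 * PowerSeries.X * PowerSeries.derivative ℂ (ramanujanPSeries.map (Int.castRingHom ℂ)) = substSeries f (A 1)
        rw [E0, mul_assoc, h1, ← mul_assoc, c12, one_mul]
      · show 12 * PowerSeries.X * PowerSeries.derivative ℂ (ramanujanQSeries.map (Int.castRingHom ℂ)) = substSeries f (A 2)
        rw [E1, mul_assoc, h2, ← mul_assoc, c3]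
      · show 12 * PowerSeries.X * PowerSeries.derivative ℂ (ramanujanRSeries.map (Int.castRingHom ℂ)) = substSeries f (A 3)
        rw [E2, mul_assoc, h3, ← mul_assoc, c2]
  -- the `D`-property: stability under `12D` is stability under `D`
  have hDprop : HasDProperty A f := by
    refine ⟨c, fun 𝔞 h𝔞 hne hst => ?_⟩
    have hst' : IsRamanujanDStable 𝔞 := fun E hE => by
      have h12 := hst E hE
      rw [dOp_ramanujan_eq] at h12
      have : ramanujanD E = C (1 / 12 : ℂ) * (12 * ramanujanD E) := by
        rw [← mul_assoc, hC12, ← C_mul]; norm_num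
      rw [this]
      exact 𝔞.mul_mem_left _ h12
    obtain ⟨E, hE, hord⟩ := hc 𝔞 h𝔞 hne hst'
    exact ⟨E, hE, by rwa [hsubst]⟩
  obtain ⟨c₁, -, H⟩ := h 3 (by norm_num) A f hND hrad hsol hDprop
  refine ⟨c₁, fun E hE => ?_⟩
  have := H E hE
  rwa [hsubst, xDegree_eq_weightedTotalDegree] at this

/-- **Ch. 3 Theorem 2.3 from the GENERAL Ch. 10 Theorem 1.1 and Proposition 5.1.**
[cite: NesterenkoPhilippon2001, Ch. 10 §1 Theorem 1.3 (p. 151) and §5 (p. 161)] -/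
theorem ch3_thm_2_3_of_general_ch10 (h11 : NesterenkoMultiplicity.NesterenkoPhilippon2001_ch10_thm_1_1)
    (h51 : NesterenkoPhilippon2001_ch10_prop_5_1) : NesterenkoPhilippon2001_ch3_thm_2_3 :=
  ch3_thm_2_3_of_thm_1_1_of_prop_5_1 (ch10_thm_1_1_ramanujan_of_general h11) h51

/-- **`NesterenkoModularScope` on the trust base {§4 facts of Ch. 3 ([Nes10]), Ch. 10 Thm 1.1
(general), Ch. 10 Prop 5.1}** (second proof of Ch. 3 Theorem 1.1; Philippon's criterion unused).
[cite: NesterenkoPhilippon2001, Ch. 3 §§2–5, Ch. 10 §§1, 5] -/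
theorem nesterenkoModularScope_of_toolkit_of_general_ch10
    (h44 : Nesterenko.NesterenkoPhilippon2001_ch3_prop_4_4)
    (h47 : Nesterenko.NesterenkoPhilippon2001_ch3_prop_4_7)
    (h49 : Nesterenko.NesterenkoPhilippon2001_ch3_cor_4_9)
    (h410 : Nesterenko.NesterenkoPhilippon2001_ch3_cor_4_10)
    (h412 : Nesterenko.NesterenkoPhilippon2001_ch3_cor_4_12)
    (h413 : Nesterenko.NesterenkoPhilippon2001_ch3_prop_4_13)
    (h11 : NesterenkoMultiplicity.NesterenkoPhilippon2001_ch10_thm_1_1)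
    (h51 : NesterenkoPhilippon2001_ch10_prop_5_1) : NesterenkoModularScope :=
  nesterenkoModularScope_of_toolkit_of_thm_2_3 h44 h47 h49 h410 h412 h413
    (ch3_thm_2_3_of_general_ch10 h11 h51)

/-- **`NesterenkoModularScope` on the trust base {Philippon 1986 Thm 2.11, Ch. 10 Thm 1.1 (general),
Ch. 10 Prop 5.1}** (the printed proof of Ch. 3 §§2–3, Lemmas 3.1 and 3.4 being discharged).
[cite: NesterenkoPhilippon2001, Ch. 3 §§2–3, Ch. 10 §§1, 5] -/
theorem nesterenkoModularScope_of_mainCriterion_of_general_ch10 (hmain : Philippon1986_mainCriterion)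
    (h11 : NesterenkoMultiplicity.NesterenkoPhilippon2001_ch10_thm_1_1)
    (h51 : NesterenkoPhilippon2001_ch10_prop_5_1) : NesterenkoModularScope :=
  nesterenkoModularScope_of_mainCriterion_of_thm_2_3 hmain (ch3_thm_2_3_of_general_ch10 h11 h51)

/-- Corollary 1.2 (`π, e^π, Γ(1/4)` algebraically independent) on the trust base {§4 facts of
Ch. 3, Ch. 10 Thm 1.1 (general), Prop 5.1}. [cite: NesterenkoPhilippon2001, Ch. 3 Cor. 1.2] -/
theorem nesterenko_of_toolkit_of_general_ch10
    (h44 : Nesterenko.NesterenkoPhilippon2001_ch3_prop_4_4)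
    (h47 : Nesterenko.NesterenkoPhilippon2001_ch3_prop_4_7)
    (h49 : Nesterenko.NesterenkoPhilippon2001_ch3_cor_4_9)
    (h410 : Nesterenko.NesterenkoPhilippon2001_ch3_cor_4_10)
    (h412 : Nesterenko.NesterenkoPhilippon2001_ch3_cor_4_12)
    (h413 : Nesterenko.NesterenkoPhilippon2001_ch3_prop_4_13)
    (h11 : NesterenkoMultiplicity.NesterenkoPhilippon2001_ch10_thm_1_1)
    (h51 : NesterenkoPhilippon2001_ch10_prop_5_1) : Literature.NumberTheory.Transcendental.nesterenko :=
  nesterenko_of_toolkit_of_thm_2_3 h44 h47 h49 h410 h412 h413 (ch3_thm_2_3_of_general_ch10 h11 h51)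

end Literature.Barriers.Schanuel

end
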